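import Literature.Computability.QuantumComplexity.ForrelationDerivativeTables
import Literature.Computability.QuantumComplexity.ForrelationSignTransport
import Literature.Computability.QuantumComplexity.ForrelationDirectSum

/-!
# Crux `CubicForrelation.NearExactIsExact` (stmt-QuantumAdvantage-14043) — perturbation of an exact pair

Line `direct-sum-amplification`, helper stub `qp_forrelation_perturb` (tag QP).

Let `n = m + m` and let `(d, g)` be an EXACT pair in dual form: `W_g(x) = 2^m · (-1)^{d(x)}` for every `x`
(`W_g(x) = Σ_y (-1)^{g(y)} (-1)^{y·x}` the unnormalised Walsh transform, `DerivativeWalsh.W`). For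
ARBITRARY Boolean perturbations `p` (of `g`) and `q` (of `d`) the forrelation of the perturbed pair is the
`W_p`-weighted average of the biases of the functions `x ↦ d(x) ⊕ d(x ⊕ w) ⊕ q(x)`:

  `Φ(d ⊕ q, g ⊕ p) = 2^{-2n} · Σ_w W_p(w) · Σ_x (-1)^{d(x) ⊕ d(x ⊕ w) ⊕ q(x)}`   (`qp_forrelation_perturb`).

Proof (the convolution theorem, from character orthogonality only):
* `Φ(a, b) = 2^{-3n/2} Σ_x (-1)^{a(x)} W_b(x)` (`phi_signOf`, `phi_eq_fsum`, `fsum_eq_sum_mul_W`);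
* Walsh inversion `Σ_w W_P(w) (-1)^{y·w} = 2ⁿ P(y)` (`qp_sum_W_mul_twist`, from `Simon.sum_twist`);
* hence the convolution identity `2ⁿ · W_{G·P}(x) = Σ_w W_P(w) W_G(x ⊕ w)` (`qp_two_pow_mul_W_mul`);
* with `G = (-1)^g`, `P = (-1)^p` and the dual form of `W_g`: `W_{g ⊕ p}(x) = 2^{m-n} Σ_w W_p(w) (-1)^{d(x ⊕ w)}`;
* reorder the two sums and collect `2^{-3m} · 2^{-2m} · 2^{m} = 2^{-2n}`.

Sanity check `p = q = 0`: `W_0(w) = 2ⁿ [w = 0]`, the inner sum at `w = 0` is `2ⁿ`, total `1 = Φ(d, g)`.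

Sources: S. Aaronson, A. Ambainis, Forrelation, SIAM J. Comput. 47 (2018) §1.1.1 (definition of `Φ`);
R. O'Donnell, Analysis of Boolean Functions (2014), §1.4 (orthogonality of characters, convolution) —
orientation only; everything below is proved from scratch, axioms are the standard three.

Imports: only the `Literature` forrelation files (they bring `forrelation`, `signOf`, `twist`,
`DerivativeWalsh.W`); the Theses file `Summits.…Theses.CubicForrelation` is deliberately NOT imported.
-/

set_option linter.dupNamespace false -- D-0017: single-problem summit

namespace Summit.QuantumAdvantage.QuantumAdvantage.Theorems.CubicForrelation.NearExactIsExact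

open Finset
open Literature.Computability.QuantumComplexity
open Literature.Computability.QuantumComplexity.BuzetChailloux (bxor zeroVec signOf_sq phi_signOf
  bxor_eq_zeroVec_iff twist_bxor_right)
open Literature.Computability.QuantumComplexity.DerivativeWalsh (W fsum phi_eq_fsum fsum_eq_sum_mul_W
  twist_bxor_left)

variable {n : ℕ}

/-- Walsh inversion for the unnormalised transform: `Σ_w W_P(w) (-1)^{y·w} = 2ⁿ · P(y)`
(orthogonality of characters, `Simon.sum_twist`). -/
theorem qp_sum_W_mul_twist (P : (Fin n → Bool) → ℝ) (y : Fin n → Bool) :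
    ∑ w, W P w * twist y w = (2 : ℝ) ^ n * P y := by
  have key : ∀ z : Fin n → Bool, ∑ w, twist (bxor z y) w = if z = y then (2 : ℝ) ^ n else 0 := by
    intro z
    rw [Simon.sum_twist]
    exact if_congr (bxor_eq_zeroVec_iff z y) rfl rfl
  calc ∑ w, W P w * twist y w = ∑ w, ∑ z, P z * (twist z w * twist y w) := by
        refine sum_congr rfl fun w _ => ?_
        simp only [W, sum_mul]
        exact sum_congr rfl fun z _ => mul_assoc _ _ _
    _ = ∑ z, P z * ∑ w, twist (bxor z y) w := by
        rw [sum_comm]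
        refine sum_congr rfl fun z _ => ?_
        rw [mul_sum]
        exact sum_congr rfl fun w _ => by rw [twist_bxor_left]
    _ = ∑ z, P z * (if z = y then (2 : ℝ) ^ n else 0) := sum_congr rfl fun z _ => by rw [key]
    _ = (2 : ℝ) ^ n * P y := by
        rw [sum_eq_single y (fun z _ hz => by rw [if_neg hz, mul_zero])
          (fun h => absurd (mem_univ y) h), if_pos rfl, mul_comm]

/-- Convolution theorem for the unnormalised Walsh transform:
`2ⁿ · W_{G·P}(x) = Σ_w W_P(w) · W_G(x ⊕ w)`. -/
theorem qp_two_pow_mul_W_mul (G P : (Fin n → Bool) → ℝ) (x : Fin n → Bool) :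
    (2 : ℝ) ^ n * W (fun y => G y * P y) x = ∑ w, W P w * W G (bxor x w) := by
  calc (2 : ℝ) ^ n * W (fun y => G y * P y) x = ∑ y, G y * ((2 : ℝ) ^ n * P y) * twist y x := by
        simp only [W, mul_sum]
        exact sum_congr rfl fun y _ => by ring
    _ = ∑ y, G y * (∑ w, W P w * twist y w) * twist y x :=
        sum_congr rfl fun y _ => by rw [qp_sum_W_mul_twist]
    _ = ∑ y, ∑ w, W P w * (G y * twist y (bxor x w)) := by
        refine sum_congr rfl fun y _ => ?_
        rw [mul_sum, sum_mul]
        refine sum_congr rfl fun w _ => ?_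
        rw [twist_bxor_right]
        ring
    _ = ∑ w, W P w * W G (bxor x w) := by
        rw [sum_comm]
        refine sum_congr rfl fun w _ => ?_
        rw [← mul_sum]
        rfl

/-- `Φ(a, b) = 2^{-3n/2} · Σ_x (-1)^{a(x)} W_b(x)` for Boolean data. -/
theorem qp_forrelation_eq_sum_mul_W (a b : (Fin n → Bool) → Bool) :
    forrelation a b = (Real.sqrt ((2 : ℝ) ^ (3 * n)))⁻¹ * ∑ x, signOf (a x) * W (fun y => signOf (b y)) x := by
  rw [← phi_signOf, phi_eq_fsum, fsum_eq_sum_mul_W]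

/-- `√(2^{3(m+m)}) = 2^{3m}`. -/
theorem qp_sqrt_two_pow_three_mul_add_self (m : ℕ) :
    Real.sqrt ((2 : ℝ) ^ (3 * (m + m))) = (2 : ℝ) ^ (3 * m) := by
  rw [show (2 : ℝ) ^ (3 * (m + m)) = ((2 : ℝ) ^ (3 * m)) ^ 2 by ring, Real.sqrt_sq (by positivity)]

/-- **Perturbation of an exact pair** (helper stub `qp_forrelation_perturb`, line `direct-sum-amplification`).
If `W_g = 2^m · (-1)^d` on `n = m + m` bits (the dual form of an exact pair `(d, g)`), then for arbitrary
Boolean `p, q`: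
`Φ(d ⊕ q, g ⊕ p) = 2^{-2n} Σ_w W_p(w) · Σ_x (-1)^{d(x) ⊕ d(x ⊕ w) ⊕ q(x)}`. -/
theorem qp_forrelation_perturb :
    ∀ (m : ℕ) (d g p q : (Fin (m + m) → Bool) → Bool),
      (∀ x, W (fun y => signOf (g y)) x = (2 : ℝ) ^ m * signOf (d x)) →
      forrelation (fun x => d x ^^ q x) (fun y => g y ^^ p y) =
        ((2 : ℝ) ^ (2 * (m + m)))⁻¹ *
          ∑ w : Fin (m + m) → Bool, W (fun y => signOf (p y)) w *
            ∑ x : Fin (m + m) → Bool, signOf (d x ^^ d (bxor x w) ^^ q x) := by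
  intro m d g p q hdual
  -- the Walsh transform of the perturbed `g ⊕ p` through the convolution theorem and the dual form
  have hW : ∀ x, W (fun y => signOf (g y ^^ p y)) x =
      ((2 : ℝ) ^ (m + m))⁻¹ *
        ((2 : ℝ) ^ m * ∑ w, W (fun y => signOf (p y)) w * signOf (d (bxor x w))) := by
    intro x
    have h1 : W (fun y => signOf (g y ^^ p y)) x = W (fun y => signOf (g y) * signOf (p y)) x := by
      simp only [signOf_xor]
    rw [h1, eq_inv_mul_iff_mul_eq₀ (by positivity), qp_two_pow_mul_W_mul, mul_sum]
    refine sum_congr rfl fun w _ => ?_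
    rw [hdual]
    ring
  -- each summand of `Σ_x (-1)^{(d ⊕ q)(x)} W_{g ⊕ p}(x)`, expanded
  have hx : ∀ x, signOf (d x ^^ q x) * W (fun y => signOf (g y ^^ p y)) x =
      ∑ w, ((2 : ℝ) ^ (m + m))⁻¹ * (2 : ℝ) ^ m *
        (W (fun y => signOf (p y)) w * signOf (d x ^^ d (bxor x w) ^^ q x)) := by
    intro x
    rw [hW x]
    simp only [mul_sum]
    refine sum_congr rfl fun w _ => ?_
    simp only [signOf_xor]
    ring
  have hS : ∑ x, signOf (d x ^^ q x) * W (fun y => signOf (g y ^^ p y)) x =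
      ((2 : ℝ) ^ (m + m))⁻¹ * (2 : ℝ) ^ m *
        ∑ w, W (fun y => signOf (p y)) w * ∑ x, signOf (d x ^^ d (bxor x w) ^^ q x) := by
    rw [sum_congr rfl fun x _ => hx x, sum_comm]
    simp only [mul_sum]
  rw [qp_forrelation_eq_sum_mul_W, hS, qp_sqrt_two_pow_three_mul_add_self]
  -- constants: `2^{-3m} · 2^{-2m} · 2^m = 2^{-4m}`
  have h2 : (2 : ℝ) ^ m ≠ 0 := by positivity
  simp only [pow_mul', pow_add]
  field_simp

end Summit.QuantumAdvantage.QuantumAdvantage.Theorems.CubicForrelation.NearExactIsExact
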